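import Summits.QuantumFields.BalabanUV.T4Continuum.Support.B13AssemblyCoresEndActNorm

/-!
# B13AssemblyCoresEndRestrict — row O1-d2-ii «act instance» of the NE5 crux O1, follower of parts 2 and 9: THE (2.14)-FACTOR-CORE END OF
# RECORD FOR SLOTS WHOSE ACTIVITY SLOT **IS** `actOfCores 𝔠` OVER THE FULL OPERATOR-DATUM SPACE `OpDatum E` — conclusion about the
# instance's OWN outputs `B13StepOfRecord.outA ∕ outB S₀ E₀ cB` — through leaf-03∕leaf-09's `restrict` and a new operator-slot comap
# `BiCore.comapOp` of part 2's cores (cell `pub-balaban`, T⁴ fan-out, `HOME/BINDER-OWNERS.md` row NE5; unit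
# `b2b-balaban-t4-ne5-formalise-leaf-08`, gen 5; journal INTENT 2026-08-20 l.14470, CLAIM RULE 1 follower of p216594 ∕ p218821)

HONEST FRAMING (T4-DAG PAGE 1).  Rung (B)+1 on ONE finite four-torus of fixed physical size — NOT infinite volume, NOT a mass gap, NOT
the Clay problem; `FlowStep.BetaPertH`, (B), (B^μ) do not occur here.  NE5 (`T4OutputRate.NE5`) is NOT PRINTED and NOT PROVED (spine
0/9, unchanged); every END below is an IMPLICATION from displayed binders, a composition BY NAME of landed faces.  Nothing of the
manuscripts under audit is asserted; 0 cite tags; printed KIND only: [II] = [Balaban1988RG2Cluster] (2.14) p. 15 (the activities), Lemma 3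
(2.38) p. 20, (2.40) p. 21, (1.26).  HONEST DEPENDENCY (cell, verbatim): continuum YM on T⁴ ⇐ BetaPertH ∧ nine spine estimates (0/9
proved); BetaPertH ⇐ (D1) ∧ (D4) ∧ CAP+tail; G-an2-4 gates asym, D1 and NE2/3/4.

WHY (located interface point F-ne5leaf08g5-1, journal l.14470).  The (2.14)-factor-core END of record — part 9 §2
`B13AssemblyCoresEnd.ne5_of_record_onSub_cores` and leaf-04-g3's diamond `B13AssemblyCoresEndActNorm.ne5_of_record_onSub_cores_actNorm`
(owner R37) — takes the cores `𝔠 : ∀ Z ℓ, BiCore P (dom Z ℓ) ↥M …` typed ON THE SUB-SLOT `↥M` (owner R20, of record `↥measOp`) and concludes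
about `outA ∕ outB (onSub S₀ M hMA hMB (actOfCores 𝔠)) E₀ cB`.  An O1 instance, however, fills leaf-09's `B13StepOfRecord.Slots` with an
activity slot `S₀.act := actOfCores 𝔠` whose cores are typed over the FULL operator-datum space `OpDatum E` (so does the substrate cell's
`SubstrateSlotsOfRecord.slotsOfRecord`, `act := SubstrateActivities.actOfLetters … = actOfCores (coreOf …)`), and what node U3's consumers
read are the instance's OWN outputs `B13StepOfRecord.outA ∕ outB S₀ E₀ cB`.  Leaf-03∕leaf-09's `B13StepOfRecordSub.restrict S₀ M hA hB`
(cores := `S₀.act` read through the inclusion `↥M → OpDatum E`) has EXACTLY these outputs (`outA_restrict` ∕ `outB_restrict`, `rfl`), and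
`(restrict S₀ M hA hB).act = actOfCores (fun Z ℓ => (𝔠 Z ℓ).comapOp (↑))` once part 2's `BiCore` can be precomposed in its OPERATOR slot —
the one map this file adds (`comapV`, part 4, transports the fluctuation slot; the operator slot had no comap).

WHAT THIS MODULE IS (bookkeeping ∕ [folklore]; ONE 18-field structure map + `rfl`s + compositions BY NAME; no estimate):
* §1 `BiCore.comapOp 𝔠 f` (`N ↦ N ∘ f`, `q ↦ q ∘ f`, every other field unchanged) with its `rfl` views, **`termAt_comapOp :
  (𝔠.comapOp f).termAt o h = 𝔠.termAt (f o) h`** (part 4's `termAt` reads `N o`, `q o` structurally); for families: `comapCores 𝔠 f`,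
  `actOfCores_comapCores`, `factorCores_comapCores`, `factorMass_comapCores` (= `factorMass 𝔠`, `rfl`); transfer helpers `mem_ball_mk_iff` ∕
  `differentiableOn_coe_of_ball` (sub-slot balls = `OpDatum E`-balls read at `↑o`, the inclusion being an isometry); and on the carriers of record
  **`restrict_eq_onSub_comapCores (hact : S₀.act = actOfCores 𝔠) : restrict S₀ M hA hB = onSub S₀ M hA hB (actOfCores (comapCores 𝔠 (↑)))`**.
* §2 **`ne5_of_record_cores`** — part 9 §2 for ANY `S₀ : B13StepOfRecord.Slots R E IOp (B13HistM P)` with `hact : S₀.act = actOfCores 𝔠`, `𝔠`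
  over `OpDatum E`: binder by binder part 9 §2's list with the cores' factor letters `hNf` ∕ `hqf` READ AT `(o : OpDatum E)` for `o` in the
  sub-slot balls about `⟨opOf S₀.F S₀.rawB g U k, hMB g U k⟩`, the levels `hdA` ∕ `hdB` and the CONCLUSION about `B13StepOfRecord.outA ∕ outB
  S₀ E₀ cB`; every other binder VERBATIM and in part 9's order; SAME constant.  Conclusion LITERALLY
  `T4OutputRate.NE5 (B13StepOfRecord.outA S₀ E₀ cB) (B13StepOfRecord.outB S₀ E₀ cB) W κ θ′ C₅`.  PROOF: part 9 §2 BY NAME at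
  `𝔠 := comapCores 𝔠 (↑)` + §1 + `outA_restrict` ∕ `outB_restrict` (no transport re-derived, R32).
* §3 **`ne5_of_record_cores_actNorm`** + **`exists_ne5_of_record_cores_actNorm`** — leaf-04-g3's diamond §2 ∕ §3 the same way (termwise
  budget binders from the STRIPPED factor-mass majorant `A′`, its factorwise decay split and anchored exponential norm `Φ′`, `36Φ′ < 1`;
  §3bis with the arithmetic letters eliminated ⟹ `∃ C₅, NE5 (B13StepOfRecord.outA S₀ E₀ cB) (B13StepOfRecord.outB S₀ E₀ cB) W κ θ′ C₅`).
CONSUMER (offered, journal l.14470; R34 — the O1 INSTANCE is the substrate cell's): at `S₀ := SubstrateSlotsOfRecord.slotsOfRecord …` take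
`hact := slotsOfRecord_act` (`rfl`); `hNf` ∕ `hqf` then reduce by `SubstrateActivities.coreOf_N ∕ _q` + `coreLettersOf_N ∕ _q` (`rfl`) to the
substrate's `gaussN ∕ gaussQ ∘ linForm` clauses (`SubstrateGaussianLetters(Ball)`).  Nothing of that instance is imported or asserted here.
STATUS (census, Edison rule).  Discharges NO estimate of [II]: the factor operator letters, the factor-mass budget (or `A′`, decay split,
`Φ′`), the transport reading, the slice budgets (W3 side), the levels (L05∕L06), W1 in row NE2's entry currency + floor, W4, rooms and the
numerics stay DISPLAYED.  NE5 NOT PROVED; 0/12 leaves on Bałaban's concrete objects; spine 0/9; rung (B)+1 finite T⁴; NOT infinite volume ∕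
mass gap ∕ Clay.  0 sorry; axioms ⊆ {propext, Classical.choice, Quot.sound}.
-/

noncomputable section

open scoped BigOperators
open Metric MeasureTheory

/-! ## §1 The operator-slot comap of a (2.14)-core -/

namespace Summit.QuantumFields.BalabanUV.T4Continuum.B13TermParamGaussianBi.BiCore

open Literature.MathematicalPhysics.QuantumFieldTheory.Balaban1983to89
open Literature.MathematicalPhysics.QuantumFieldTheory.Balaban1983to89.T4OutputRate (Carriers)
open Summit.QuantumFields.BalabanUV.T4Continuum.B13HistMeasurable (MeasPotFrame B13HistM)

variable {C : Carriers} {P : MeasPotFrame C} {𝒴 : Type*} {dom : 𝒴 → C.Dom}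
variable {Op Op' PΛ V : Type*} [MeasurableSpace PΛ] [NormedAddCommGroup V] [InnerProductSpace ℝ V] [MeasurableSpace V]

/-- **PRECOMPOSITION IN THE OPERATOR SLOT** along any map `f : Op′ → Op` of operator carriers (e.g. the inclusion `↥M → OpDatum E` of
the sub-slot of record): the operator LETTERS `N`, `q` are read at `f o`; parameter measure, weight, constraints, polymer family, contour
weights, radii and field maps unchanged. [folklore] -/
def comapOp (𝔠 : BiCore P dom Op PΛ V) (f : Op' → Op) : BiCore P dom Op' PΛ V where
  lam := 𝔠.lam
  finite := 𝔠.finite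
  w := 𝔠.w
  measW := 𝔠.measW
  wB := 𝔠.wB
  norm_w_le := 𝔠.norm_w_le
  N o := 𝔠.N (f o)
  q o := 𝔠.q (f o)
  cons := 𝔠.cons
  nsign := 𝔠.nsign
  D := 𝔠.D
  τ := 𝔠.τ
  measτ := 𝔠.measτ
  rad := 𝔠.rad
  rad_nonneg := 𝔠.rad_nonneg
  norm_τ_le := 𝔠.norm_τ_le
  B := 𝔠.B
  measB := 𝔠.measB

variable (𝔠 : BiCore P dom Op PΛ V) (f : Op' → Op)

/-- [folklore] parameter measure unchanged. -/ @[simp] theorem comapOp_lam : (𝔠.comapOp f).lam = 𝔠.lam := rfl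
/-- [folklore] weight unchanged. -/ @[simp] theorem comapOp_w : (𝔠.comapOp f).w = 𝔠.w := rfl
/-- [folklore] weight letter unchanged. -/ @[simp] theorem comapOp_wB : (𝔠.comapOp f).wB = 𝔠.wB := rfl
/-- [folklore] the normalisation letter is read at `f o`. -/ @[simp] theorem comapOp_N (o : Op') : (𝔠.comapOp f).N o = 𝔠.N (f o) := rfl
/-- [folklore] the exponent letter is read at `f o`. -/ @[simp] theorem comapOp_q (o : Op') : (𝔠.comapOp f).q o = 𝔠.q (f o) := rfl
/-- [folklore] constraints unchanged. -/ @[simp] theorem comapOp_cons : (𝔠.comapOp f).cons = 𝔠.cons := rfl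
/-- [folklore] sign exponent unchanged. -/ @[simp] theorem comapOp_nsign : (𝔠.comapOp f).nsign = 𝔠.nsign := rfl
/-- [folklore] polymer family unchanged. -/ @[simp] theorem comapOp_D : (𝔠.comapOp f).D = 𝔠.D := rfl
/-- [folklore] contour weights unchanged. -/ @[simp] theorem comapOp_τ : (𝔠.comapOp f).τ = 𝔠.τ := rfl
/-- [folklore] radii unchanged. -/ @[simp] theorem comapOp_rad : (𝔠.comapOp f).rad = 𝔠.rad := rfl
/-- [folklore] field maps unchanged. -/ @[simp] theorem comapOp_B : (𝔠.comapOp f).B = 𝔠.B := rfl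
/-- [folklore] the constraint set is unchanged. -/ theorem chiSet_comapOp : (𝔠.comapOp f).chiSet = 𝔠.chiSet := rfl
/-- [folklore] the potential-free factor is unchanged. -/ theorem chi_comapOp : (𝔠.comapOp f).chi = 𝔠.chi := rfl
/-- [folklore] the history read-out is unchanged. -/ theorem readOut_comapOp : (𝔠.comapOp f).readOut = 𝔠.readOut := rfl
/-- [folklore] the read-out letter `N₁` is unchanged. -/ theorem N₁_comapOp : (𝔠.comapOp f).N₁ = 𝔠.N₁ := rfl

variable [BorelSpace V] [FiniteDimensional ℝ V]

/-- [folklore] **THE TERM OF THE COMAPPED CORE IS THE TERM READ AT `f o`** (`rfl`: part 4's `termAt` reads `N o`, `q o` structurally). -/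
theorem termAt_comapOp (o : Op') (h : B13HistM P) : (𝔠.comapOp f).termAt o h = 𝔠.termAt (f o) h := rfl

end Summit.QuantumFields.BalabanUV.T4Continuum.B13TermParamGaussianBi.BiCore

namespace Summit.QuantumFields.BalabanUV.T4Continuum.B13AssemblyCoresEndRestrict

open Literature.MathematicalPhysics.QuantumFieldTheory.Balaban1983to89
open Literature.MathematicalPhysics.QuantumFieldTheory.Balaban1983to89.T4OutputRate (Carriers Functional DecayBound NE5)
open Summit.QuantumFields.BalabanUV.T4Continuum.B13Carriers (TwoRuns)
open Summit.QuantumFields.BalabanUV.T4Continuum.B13OpDatum (OpDatum)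
open Summit.QuantumFields.BalabanUV.T4Continuum.B13OpDatumJunctions (opOf RawBounded WeightedEntrywiseRate)
open Summit.QuantumFields.BalabanUV.T4Continuum.B13StepTermLabels (TermIdx InnerLabel)
open Summit.QuantumFields.BalabanUV.T4Continuum.B13StepTermFamily (TermIndexing)
open Summit.QuantumFields.BalabanUV.T4Continuum.B13InnerData (Bnd b13InnerData)
open Summit.QuantumFields.BalabanUV.T4Continuum.B13HistMeasurable (MeasPotFrame B13HistM)
open Summit.QuantumFields.BalabanUV.T4Continuum.B13TermRep (actMajorant)
open Summit.QuantumFields.BalabanUV.T4Continuum.B13TermParamGaussianBi (BiCore)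
open Summit.QuantumFields.BalabanUV.T4Continuum.B13TermCoreFamily (actOfCores factorCores)
open Summit.QuantumFields.BalabanUV.T4Continuum.B13TermCoreMass (factorMass)
open Summit.QuantumFields.BalabanUV.T4Continuum.UrsellTreeSum (ind)
open Summit.QuantumFields.BalabanUV.T4Continuum.UrsellTermBudget (actSum)
open Summit.QuantumFields.BalabanUV.T4Continuum.B13DomainGeometryTR (SCube footprint)
open Summit.QuantumFields.BalabanUV.T4Continuum.B13StepOfRecord (Slots assembly step)
open Summit.QuantumFields.BalabanUV.T4Continuum.B13StepOfRecordSub (onSub restrict outA outB outA_restrict outB_restrict)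
open Summit.QuantumFields.BalabanUV.T4Continuum.OutputRateTermwiseLoc (TermBudgetLoc)
open Summit.QuantumFields.BalabanUV.T4Continuum.B13AssemblyCoresEnd (ne5_of_record_onSub_cores)
open Summit.QuantumFields.BalabanUV.T4Continuum.B13AssemblyCoresEndActNorm (ne5_of_record_onSub_cores_actNorm
  exists_ne5_of_record_onSub_cores_actNorm)

/-! ### §1b Families of cores comapped in the operator slot -/

section Families

variable {C : Carriers} {P : MeasPotFrame C} {Op Op' : Type*} {ι Pol J : Type*} (𝒯 : TermIndexing C ι Pol J)
  {𝒴 : Pol → J → Type*} {dom : ∀ Z j, 𝒴 Z j → C.Dom} {PΛ : Pol → J → Type*} {V : Pol → J → Type*}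
  [∀ Z j, MeasurableSpace (PΛ Z j)] [∀ Z j, NormedAddCommGroup (V Z j)] [∀ Z j, InnerProductSpace ℝ (V Z j)]
  [∀ Z j, MeasurableSpace (V Z j)] (𝔠 : ∀ Z j, BiCore P (dom Z j) Op (PΛ Z j) (V Z j)) (f : Op' → Op)

/-- The family of cores comapped in the operator slot along `f`. [folklore] -/
abbrev comapCores : ∀ Z j, BiCore P (dom Z j) Op' (PΛ Z j) (V Z j) := fun Z j => (𝔠 Z j).comapOp f

/-- [folklore] The factor cores of the comapped family are the comapped factor cores (`rfl`). -/
theorem factorCores_comapCores (i : ι) (m : Fin (𝒯.len i + 1)) :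
    factorCores 𝒯 (comapCores 𝔠 f) i m = (factorCores 𝒯 𝔠 i m).comapOp f := rfl

/-- [folklore] **THE FACTOR MASSES ARE UNCHANGED** (`rfl`: part 8's `factorMass` reads `lam`, `wB`, `N₁` and the dimension only). -/
theorem factorMass_comapCores (N₀f bf : Pol → J → ℝ) (mstar H : ℝ) :
    factorMass (comapCores 𝔠 f) N₀f bf mstar H = factorMass 𝔠 N₀f bf mstar H := rfl

variable [∀ Z j, BorelSpace (V Z j)] [∀ Z j, FiniteDimensional ℝ (V Z j)]

/-- [folklore] **THE ACTIVITIES OF THE COMAPPED FAMILY ARE THE ACTIVITIES READ AT `f o`** (`rfl`). -/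
theorem actOfCores_comapCores : actOfCores (comapCores 𝔠 f) = fun Z j o h => actOfCores 𝔠 Z j (f o) h := rfl

end Families

/-! ### §1c Transfer helpers: sub-slot balls vs balls of `OpDatum E` (the inclusion is an isometry) -/

section Transfer

variable {E : Type*} (M : Submodule ℂ (OpDatum E))

/-- [folklore] A point of the sub-slot lies in the sub-slot ball about `⟨c, hc⟩` iff its image lies in the ball of `OpDatum E` about `c`
(so the POINTWISE factor-letter clauses of §2 are the `OpDatum E`-ball clauses read at `↑o`). -/
theorem mem_ball_mk_iff {c : OpDatum E} (hc : c ∈ M) {r : ℝ} (o : M) :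
    o ∈ ball (⟨c, hc⟩ : M) r ↔ (o : OpDatum E) ∈ ball c r := by
  rw [mem_ball, mem_ball, dist_eq_norm, dist_eq_norm, Submodule.coe_norm, Submodule.coe_sub]

/-- [folklore] HOLOMORPHY TRANSFERS ALONG THE INCLUSION: a function holomorphic on the ball of `OpDatum E` about `c ∈ M` is, read through
`↥M → OpDatum E`, holomorphic on the sub-slot ball (the `DifferentiableOn` clauses of §2 from their `OpDatum E`-ball versions). -/
theorem differentiableOn_coe_of_ball {F : OpDatum E → ℂ} {c : OpDatum E} (hc : c ∈ M) {r : ℝ}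
    (hF : DifferentiableOn ℂ F (ball c r)) : DifferentiableOn ℂ (fun o : M => F (o : OpDatum E)) (ball (⟨c, hc⟩ : M) r) :=
  hF.comp M.subtypeL.differentiable.differentiableOn fun o ho => (mem_ball_mk_iff M hc o).1 ho

end Transfer

/-! ### §1d On the carriers of record: `restrict` IS `onSub` at the comapped cores -/

section Record

variable {G : Type} [GaugeGroup G] {R : TwoRuns G} {E IOp : Type*} {P : MeasPotFrame R.carriers}
  (S₀ : Slots R E IOp (B13HistM P)) (M : Submodule ℂ (OpDatum E))
  (hMA : ∀ g V k, opOf S₀.F S₀.rawA g V k ∈ M) (hMB : ∀ g U k, opOf S₀.F S₀.rawB g U k ∈ M)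
  {𝒴 : R.carriers.Dom → InnerLabel R.carriers.Dom (Bnd R) → Type*} {dom : ∀ Z ℓ, 𝒴 Z ℓ → R.carriers.Dom}
  {PΛ : R.carriers.Dom → InnerLabel R.carriers.Dom (Bnd R) → Type*} {V : R.carriers.Dom → InnerLabel R.carriers.Dom (Bnd R) → Type*}
  [∀ Z ℓ, MeasurableSpace (PΛ Z ℓ)] [∀ Z ℓ, NormedAddCommGroup (V Z ℓ)] [∀ Z ℓ, InnerProductSpace ℝ (V Z ℓ)]
  [∀ Z ℓ, MeasurableSpace (V Z ℓ)] [∀ Z ℓ, BorelSpace (V Z ℓ)] [∀ Z ℓ, FiniteDimensional ℝ (V Z ℓ)]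
  (𝔠 : ∀ Z ℓ, BiCore P (dom Z ℓ) (OpDatum E) (PΛ Z ℓ) (V Z ℓ)) (E₀ cB : ℝ)

include hMA hMB

/-- [folklore] **`restrict` IS `onSub` AT THE COMAPPED CORES** when the activity slot of `S₀` IS `actOfCores 𝔠`: the cores of record read
through the inclusion `↥M → OpDatum E` are the activities of the family `comapCores 𝔠 (↑)` typed on the sub-slot. -/
theorem restrict_eq_onSub_comapCores (hact : S₀.act = actOfCores 𝔠) :
    B13StepOfRecordSub.restrict S₀ M hMA hMB = onSub S₀ M hMA hMB (actOfCores (comapCores 𝔠 ((↑) : M → OpDatum E))) := by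
  unfold B13StepOfRecordSub.restrict
  rw [hact, actOfCores_comapCores]

/-! ## §2 Part 9 §2 for slots whose activity slot IS `actOfCores 𝔠` over `OpDatum E`: NE5 for the instance's own outputs -/

/-- [folklore] **THE (2.14)-FACTOR-CORE END OF RECORD FOR THE INSTANCE's OWN OUTPUTS.**  Part 9 §2
`B13AssemblyCoresEnd.ne5_of_record_onSub_cores` for ANY slots object `S₀` whose activity slot IS `actOfCores 𝔠` (`hact`), the (2.14)-cores
`𝔠` typed over the FULL operator-datum space `OpDatum E`, on a ℂ-submodule `M ∋` both runs' operator data of record: binder by binder part 9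
§2's list — the transport reading `hT`, the slice budgets `hbB`∕`hbA`, the levels `hdA`∕`hdB` (now about `B13StepOfRecord.outA∕outB S₀ E₀ cB`),
W1 in row NE2's entry currency `hRA`∕`hRB`∕`hwer` + floor `hfl`, W4 `hins`, the termwise budget `hbud`, rooms `hOp`∕`hroom`∕`hHist`, the FACTOR
operator letters `hm`∕`hmf`∕`hwB`∕`hN₀`∕`hNf`∕`hqf` (READ AT `(o : OpDatum E)` for `o` in the sub-slot ball of radius `R′ k` about run B's
datum of record), the history radius `hH`, the per-domain factor-mass budget `hmaj`, numerics.  Conclusion LITERALLY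
`T4OutputRate.NE5 (B13StepOfRecord.outA S₀ E₀ cB) (B13StepOfRecord.outB S₀ E₀ cB) W κ θ′ C₅`, SAME `C₅` as part 9.  NOT NE5 proved — an
implication from displayed binders; nothing instantiated on Bałaban's concrete objects. -/
theorem ne5_of_record_cores (hact : S₀.act = actOfCores 𝔠) {W : Set (ℕ → ℝ)} {ROp RHist R' H : ℕ → ℝ}
    {a : ℕ → TermIdx R.carriers.Dom (Bnd R) → R.carriers.Dom → ℝ}
    {N₀f mf bf : R.carriers.Dom → InnerLabel R.carriers.Dom (Bnd R) → ℝ}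
    {mstar κ G EA₀ E₁ cA c₁ r₀ δ' θ θ' ρ₀ B : ℝ} {k₀ : ℕ}
    (hT : (assembly S₀).TransportReads W)
    (hbB : (assembly S₀).SliceBudgetB W κ cB) (hbA : S₀.D.SliceBudget (step S₀ E₀ cB) W κ cA)
    (hdA : DecayBound (B13StepOfRecord.outA S₀ E₀ cB) W EA₀ κ)
    (hdB : DecayBound (B13StepOfRecord.outB S₀ E₀ cB) W E₀ κ)
    (hRA : RawBounded S₀.F (assembly S₀).rawAt W) (hRB : RawBounded S₀.F S₀.rawB W)
    (hwer : WeightedEntrywiseRate S₀.F (assembly S₀).rawAt S₀.rawB W c₁ fun k => θ ^ k) (hfl : ∀ k, r₀ ≤ S₀.rOp k)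
    (hins : (step S₀ E₀ cB).InsertionRate W κ E₀ δ' θ)
    (hbud : TermBudgetLoc a G) (hOp : ∀ k, S₀.rOp k ≤ ROp k) (hroom : ∀ k, ROp k < R' k)
    (hHist : ∀ k, (assembly S₀).bHist E₀ cB k + S₀.rHist k ≤ RHist k)
    -- the FACTOR operator letters of the cores, READ AT `(o : OpDatum E)` on the sub-slot balls about run B's datum of record
    (hm : 0 < mstar) (hmf : ∀ Z ℓ, mstar ≤ mf Z ℓ) (hwB : ∀ Z ℓ, 0 ≤ (𝔠 Z ℓ).wB) (hN₀ : ∀ Z ℓ, 0 ≤ N₀f Z ℓ)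
    (hNf : ∀ k, ∀ g ∈ W, ∀ (U : R.carriers.BgB) (X : R.carriers.Dom), R.carriers.scale X = k →
      ∀ i, (assembly S₀).𝒯.Rel k i X → ∀ m : Fin ((assembly S₀).𝒯.len i + 1),
      (∀ o ∈ ball (⟨opOf S₀.F S₀.rawB g U k, hMB g U k⟩ : M) (R' k),
        AEStronglyMeasurable ((factorCores (assembly S₀).𝒯 𝔠 i m).N (o : OpDatum E)) (factorCores (assembly S₀).𝒯 𝔠 i m).lam) ∧
      (∀ p, DifferentiableOn ℂ (fun o : M => (factorCores (assembly S₀).𝒯 𝔠 i m).N (o : OpDatum E) p)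
        (ball (⟨opOf S₀.F S₀.rawB g U k, hMB g U k⟩ : M) (R' k))) ∧
      (∀ o ∈ ball (⟨opOf S₀.F S₀.rawB g U k, hMB g U k⟩ : M) (R' k), ∀ p,
        ‖(factorCores (assembly S₀).𝒯 𝔠 i m).N (o : OpDatum E) p‖ ≤ N₀f ((assembly S₀).𝒯.poly i m) ((assembly S₀).𝒯.lab i m)))
    (hqf : ∀ k, ∀ g ∈ W, ∀ (U : R.carriers.BgB) (X : R.carriers.Dom), R.carriers.scale X = k →
      ∀ i, (assembly S₀).𝒯.Rel k i X → ∀ m : Fin ((assembly S₀).𝒯.len i + 1),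
      (∀ o ∈ ball (⟨opOf S₀.F S₀.rawB g U k, hMB g U k⟩ : M) (R' k),
        AEStronglyMeasurable (Function.uncurry ((factorCores (assembly S₀).𝒯 𝔠 i m).q (o : OpDatum E)))
          ((factorCores (assembly S₀).𝒯 𝔠 i m).lam.prod volume)) ∧
      (∀ p v, DifferentiableOn ℂ (fun o : M => (factorCores (assembly S₀).𝒯 𝔠 i m).q (o : OpDatum E) p v)
        (ball (⟨opOf S₀.F S₀.rawB g U k, hMB g U k⟩ : M) (R' k))) ∧
      (∀ o ∈ ball (⟨opOf S₀.F S₀.rawB g U k, hMB g U k⟩ : M) (R' k), ∀ p v,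
        mf ((assembly S₀).𝒯.poly i m) ((assembly S₀).𝒯.lab i m) * ‖v‖ ^ 2 - bf ((assembly S₀).𝒯.poly i m) ((assembly S₀).𝒯.lab i m) ≤
          ((factorCores (assembly S₀).𝒯 𝔠 i m).q (o : OpDatum E) p v).re))
    -- the history radius about the record's history reference, and the per-domain FACTOR-MASS budget
    (hH : ∀ k, ∀ g ∈ W, ∀ U : R.carriers.BgB, ‖(assembly S₀).histRef g U k‖ + RHist k ≤ H k)
    (hmaj : ∀ k, ∀ g ∈ W, ∀ (U : R.carriers.BgB) (X : R.carriers.Dom), R.carriers.scale X = k → ∀ i,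
      actMajorant (assembly S₀).𝒯 (assembly S₀).inc (factorMass 𝔠 N₀f bf mstar (H k)) k X i ≤
        a k i X * Real.exp (-(κ * R.carriers.d X)))
    (hE₀ : 0 ≤ E₀) (hE₁ : 0 < E₁) (hG : 0 ≤ G) (hcA : 0 ≤ cA) (hcB : 0 ≤ cB) (hc₁ : 0 ≤ c₁) (hr₀ : 0 < r₀) (hδ' : 0 ≤ δ')
    (hθ : 0 ≤ θ) (hθθ' : θ ≤ θ') (hθ'1 : θ' ≤ 1) (hω : 0 < S₀.D.ω) (hω1 : S₀.D.ω < 1) (hρ₀ : ρ₀ < 1)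
    (hnear : (c₁ / r₀ + δ') * θ ^ k₀ + cA * (EA₀ + E₀) / (1 - S₀.D.ω) ≤ ρ₀) (hB : 0 ≤ B)
    (hfirst : ∀ k < k₀, EA₀ + E₀ ≤ B * θ ^ k) (hsmall : S₀.D.ω + G / (1 - ρ₀) * cA < θ') :
    NE5 (B13StepOfRecord.outA S₀ E₀ cB) (B13StepOfRecord.outB S₀ E₀ cB) W κ θ'
      ((G / (1 - ρ₀) * (c₁ / r₀) + G / (1 - ρ₀) * δ' + B) * (θ' - S₀.D.ω) / (θ' - (S₀.D.ω + G / (1 - ρ₀) * cA))) := by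
  have key := restrict_eq_onSub_comapCores S₀ M hMA hMB 𝔠 hact
  rw [← outA_restrict S₀ M hMA hMB E₀ cB, key] at hdA
  rw [← outB_restrict S₀ M hMA hMB E₀ cB, key] at hdB
  rw [← outA_restrict S₀ M hMA hMB E₀ cB, ← outB_restrict S₀ M hMA hMB E₀ cB, key]
  exact ne5_of_record_onSub_cores S₀ M hMA hMB (comapCores 𝔠 ((↑) : M → OpDatum E)) E₀ cB hT hbB hbA hdA hdB hRA hRB hwer hfl
    hins hbud hOp hroom hHist hm hmf hwB hN₀ hNf hqf hH hmaj hE₀ hE₁ hG hcA hcB hc₁ hr₀ hδ' hθ hθθ' hθ'1 hω hω1 hρ₀ hnear hB hfirst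
    hsmall

/-! ## §3 The diamond (leaf-04-g3) the same way: termwise budget binders from the stripped majorant's decay split and anchored norm -/

/-- [folklore] **THE DIAMOND FOR THE INSTANCE's OWN OUTPUTS.**  Leaf-04-g3's `B13AssemblyCoresEndActNorm.ne5_of_record_onSub_cores_actNorm`
(part 9 §2 with `a`, `G`, `hmaj`, `hbud`, `hG` DISCHARGED from a nonnegative STRIPPED factor-mass majorant `A′ k` with the factorwise decay split
`hdec` ((2.40)-KIND) and the anchored exponential norm `hΦ` with `36Φ′ < 1` ((2.38)+(1.26)-KIND), `G := Φ′∕(1 − 36Φ′)` volume-uniform) for ANY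
slots object whose activity slot IS `actOfCores 𝔠` over `OpDatum E` (`hact`): factor letters READ AT `(o : OpDatum E)`, levels and conclusion
about `B13StepOfRecord.outA∕outB S₀ E₀ cB`, every other binder VERBATIM and in leaf-04-g3's order, SAME constant.  NOT NE5 proved. -/
theorem ne5_of_record_cores_actNorm (hact : S₀.act = actOfCores 𝔠) {W : Set (ℕ → ℝ)} {ROp RHist R' H : ℕ → ℝ}
    {N₀f mf bf : R.carriers.Dom → InnerLabel R.carriers.Dom (Bnd R) → ℝ}
    {A' : ℕ → R.carriers.Dom → InnerLabel R.carriers.Dom (Bnd R) → ℝ}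
    {mstar κ Φ' EA₀ E₁ cA c₁ r₀ δ' θ θ' ρ₀ B : ℝ} {k₀ : ℕ}
    (hT : (assembly S₀).TransportReads W)
    (hbB : (assembly S₀).SliceBudgetB W κ cB) (hbA : S₀.D.SliceBudget (step S₀ E₀ cB) W κ cA)
    (hdA : DecayBound (B13StepOfRecord.outA S₀ E₀ cB) W EA₀ κ)
    (hdB : DecayBound (B13StepOfRecord.outB S₀ E₀ cB) W E₀ κ)
    (hRA : RawBounded S₀.F (assembly S₀).rawAt W) (hRB : RawBounded S₀.F S₀.rawB W)
    (hwer : WeightedEntrywiseRate S₀.F (assembly S₀).rawAt S₀.rawB W c₁ fun k => θ ^ k) (hfl : ∀ k, r₀ ≤ S₀.rOp k)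
    (hins : (step S₀ E₀ cB).InsertionRate W κ E₀ δ' θ)
    (hOp : ∀ k, S₀.rOp k ≤ ROp k) (hroom : ∀ k, ROp k < R' k)
    (hHist : ∀ k, (assembly S₀).bHist E₀ cB k + S₀.rHist k ≤ RHist k)
    -- the FACTOR operator letters of the cores, READ AT `(o : OpDatum E)` (as in §2)
    (hm : 0 < mstar) (hmf : ∀ Z ℓ, mstar ≤ mf Z ℓ) (hwB : ∀ Z ℓ, 0 ≤ (𝔠 Z ℓ).wB) (hN₀ : ∀ Z ℓ, 0 ≤ N₀f Z ℓ)
    (hNf : ∀ k, ∀ g ∈ W, ∀ (U : R.carriers.BgB) (X : R.carriers.Dom), R.carriers.scale X = k →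
      ∀ i, (assembly S₀).𝒯.Rel k i X → ∀ m : Fin ((assembly S₀).𝒯.len i + 1),
      (∀ o ∈ ball (⟨opOf S₀.F S₀.rawB g U k, hMB g U k⟩ : M) (R' k),
        AEStronglyMeasurable ((factorCores (assembly S₀).𝒯 𝔠 i m).N (o : OpDatum E)) (factorCores (assembly S₀).𝒯 𝔠 i m).lam) ∧
      (∀ p, DifferentiableOn ℂ (fun o : M => (factorCores (assembly S₀).𝒯 𝔠 i m).N (o : OpDatum E) p)
        (ball (⟨opOf S₀.F S₀.rawB g U k, hMB g U k⟩ : M) (R' k))) ∧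
      (∀ o ∈ ball (⟨opOf S₀.F S₀.rawB g U k, hMB g U k⟩ : M) (R' k), ∀ p,
        ‖(factorCores (assembly S₀).𝒯 𝔠 i m).N (o : OpDatum E) p‖ ≤ N₀f ((assembly S₀).𝒯.poly i m) ((assembly S₀).𝒯.lab i m)))
    (hqf : ∀ k, ∀ g ∈ W, ∀ (U : R.carriers.BgB) (X : R.carriers.Dom), R.carriers.scale X = k →
      ∀ i, (assembly S₀).𝒯.Rel k i X → ∀ m : Fin ((assembly S₀).𝒯.len i + 1),
      (∀ o ∈ ball (⟨opOf S₀.F S₀.rawB g U k, hMB g U k⟩ : M) (R' k),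
        AEStronglyMeasurable (Function.uncurry ((factorCores (assembly S₀).𝒯 𝔠 i m).q (o : OpDatum E)))
          ((factorCores (assembly S₀).𝒯 𝔠 i m).lam.prod volume)) ∧
      (∀ p v, DifferentiableOn ℂ (fun o : M => (factorCores (assembly S₀).𝒯 𝔠 i m).q (o : OpDatum E) p v)
        (ball (⟨opOf S₀.F S₀.rawB g U k, hMB g U k⟩ : M) (R' k))) ∧
      (∀ o ∈ ball (⟨opOf S₀.F S₀.rawB g U k, hMB g U k⟩ : M) (R' k), ∀ p v,
        mf ((assembly S₀).𝒯.poly i m) ((assembly S₀).𝒯.lab i m) * ‖v‖ ^ 2 - bf ((assembly S₀).𝒯.poly i m) ((assembly S₀).𝒯.lab i m) ≤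
          ((factorCores (assembly S₀).𝒯 𝔠 i m).q (o : OpDatum E) p v).re))
    (hH : ∀ k, ∀ g ∈ W, ∀ U : R.carriers.BgB, ‖(assembly S₀).histRef g U k‖ + RHist k ≤ H k)
    -- the stripped majorant's decay split and anchored exponential norm (leaf-04-g3's binders, VERBATIM)
    (hκ : 0 ≤ κ) (hA0' : ∀ k Z ℓ, 0 ≤ A' k Z ℓ)
    (hdec : ∀ k Z ℓ, factorMass 𝔠 N₀f bf mstar (H k) Z ℓ ≤ A' k Z ℓ * Real.exp (-(κ * (R.carriers.d Z + 5))))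
    (hΦ0 : 0 ≤ Φ') (hsmallΦ : 36 * Φ' < 1)
    (hΦ : ∀ (k : ℕ) (q : SCube R),
      ∑ Z ∈ R.domAt k, ind (q ∈ footprint Z) * actSum (b13InnerData R) (A' k) k Z * Real.exp ((footprint Z).card) ≤ Φ')
    (hE₀ : 0 ≤ E₀) (hE₁ : 0 < E₁) (hcA : 0 ≤ cA) (hcB : 0 ≤ cB) (hc₁ : 0 ≤ c₁) (hr₀ : 0 < r₀) (hδ' : 0 ≤ δ')
    (hθ : 0 ≤ θ) (hθθ' : θ ≤ θ') (hθ'1 : θ' ≤ 1) (hω : 0 < S₀.D.ω) (hω1 : S₀.D.ω < 1) (hρ₀ : ρ₀ < 1)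
    (hnear : (c₁ / r₀ + δ') * θ ^ k₀ + cA * (EA₀ + E₀) / (1 - S₀.D.ω) ≤ ρ₀) (hB : 0 ≤ B)
    (hfirst : ∀ k < k₀, EA₀ + E₀ ≤ B * θ ^ k) (hsmall : S₀.D.ω + Φ' / (1 - 36 * Φ') / (1 - ρ₀) * cA < θ') :
    NE5 (B13StepOfRecord.outA S₀ E₀ cB) (B13StepOfRecord.outB S₀ E₀ cB) W κ θ'
      ((Φ' / (1 - 36 * Φ') / (1 - ρ₀) * (c₁ / r₀) + Φ' / (1 - 36 * Φ') / (1 - ρ₀) * δ' + B) * (θ' - S₀.D.ω) /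
        (θ' - (S₀.D.ω + Φ' / (1 - 36 * Φ') / (1 - ρ₀) * cA))) := by
  have key := restrict_eq_onSub_comapCores S₀ M hMA hMB 𝔠 hact
  rw [← outA_restrict S₀ M hMA hMB E₀ cB, key] at hdA
  rw [← outB_restrict S₀ M hMA hMB E₀ cB, key] at hdB
  rw [← outA_restrict S₀ M hMA hMB E₀ cB, ← outB_restrict S₀ M hMA hMB E₀ cB, key]
  exact ne5_of_record_onSub_cores_actNorm S₀ M hMA hMB (comapCores 𝔠 ((↑) : M → OpDatum E)) E₀ cB hT hbB hbA hdA hdB hRA hRB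
    hwer hfl hins hOp hroom hHist hm hmf hwB hN₀ hNf hqf hH hκ hA0' hdec hΦ0 hsmallΦ hΦ hE₀ hE₁ hcA hcB hc₁ hr₀ hδ' hθ hθθ' hθ'1 hω
    hω1 hρ₀ hnear hB hfirst hsmall

/-- [folklore] **THE CHAINED DIAMOND FOR THE INSTANCE's OWN OUTPUTS** — leaf-04-g3's `exists_ne5_of_record_onSub_cores_actNorm` (the
arithmetic letters `E₁, ρ₀, k₀, B` eliminated by leaf-10's pattern: `0 < θ < 1`, `cA(EA₀ + E₀) < 1 − ω`,
`ω + (Φ′∕(1 − 36Φ′))·cA·(1 − ω)∕(1 − ω − cA(EA₀ + E₀)) < θ′`) for ANY slots object whose activity slot IS `actOfCores 𝔠` over `OpDatum E`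
(`hact`) ⟹ `∃ C₅, NE5 (B13StepOfRecord.outA S₀ E₀ cB) (B13StepOfRecord.outB S₀ E₀ cB) W κ θ′ C₅`.  NOT NE5 proved. -/
theorem exists_ne5_of_record_cores_actNorm (hact : S₀.act = actOfCores 𝔠) {W : Set (ℕ → ℝ)} {ROp RHist R' H : ℕ → ℝ}
    {N₀f mf bf : R.carriers.Dom → InnerLabel R.carriers.Dom (Bnd R) → ℝ}
    {A' : ℕ → R.carriers.Dom → InnerLabel R.carriers.Dom (Bnd R) → ℝ}
    {mstar κ Φ' EA₀ cA c₁ r₀ δ' θ θ' : ℝ}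
    (hT : (assembly S₀).TransportReads W)
    (hbB : (assembly S₀).SliceBudgetB W κ cB) (hbA : S₀.D.SliceBudget (step S₀ E₀ cB) W κ cA)
    (hdA : DecayBound (B13StepOfRecord.outA S₀ E₀ cB) W EA₀ κ)
    (hdB : DecayBound (B13StepOfRecord.outB S₀ E₀ cB) W E₀ κ)
    (hRA : RawBounded S₀.F (assembly S₀).rawAt W) (hRB : RawBounded S₀.F S₀.rawB W)
    (hwer : WeightedEntrywiseRate S₀.F (assembly S₀).rawAt S₀.rawB W c₁ fun k => θ ^ k) (hfl : ∀ k, r₀ ≤ S₀.rOp k)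
    (hins : (step S₀ E₀ cB).InsertionRate W κ E₀ δ' θ)
    (hOp : ∀ k, S₀.rOp k ≤ ROp k) (hroom : ∀ k, ROp k < R' k)
    (hHist : ∀ k, (assembly S₀).bHist E₀ cB k + S₀.rHist k ≤ RHist k)
    (hm : 0 < mstar) (hmf : ∀ Z ℓ, mstar ≤ mf Z ℓ) (hwB : ∀ Z ℓ, 0 ≤ (𝔠 Z ℓ).wB) (hN₀ : ∀ Z ℓ, 0 ≤ N₀f Z ℓ)
    (hNf : ∀ k, ∀ g ∈ W, ∀ (U : R.carriers.BgB) (X : R.carriers.Dom), R.carriers.scale X = k →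
      ∀ i, (assembly S₀).𝒯.Rel k i X → ∀ m : Fin ((assembly S₀).𝒯.len i + 1),
      (∀ o ∈ ball (⟨opOf S₀.F S₀.rawB g U k, hMB g U k⟩ : M) (R' k),
        AEStronglyMeasurable ((factorCores (assembly S₀).𝒯 𝔠 i m).N (o : OpDatum E)) (factorCores (assembly S₀).𝒯 𝔠 i m).lam) ∧
      (∀ p, DifferentiableOn ℂ (fun o : M => (factorCores (assembly S₀).𝒯 𝔠 i m).N (o : OpDatum E) p)
        (ball (⟨opOf S₀.F S₀.rawB g U k, hMB g U k⟩ : M) (R' k))) ∧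
      (∀ o ∈ ball (⟨opOf S₀.F S₀.rawB g U k, hMB g U k⟩ : M) (R' k), ∀ p,
        ‖(factorCores (assembly S₀).𝒯 𝔠 i m).N (o : OpDatum E) p‖ ≤ N₀f ((assembly S₀).𝒯.poly i m) ((assembly S₀).𝒯.lab i m)))
    (hqf : ∀ k, ∀ g ∈ W, ∀ (U : R.carriers.BgB) (X : R.carriers.Dom), R.carriers.scale X = k →
      ∀ i, (assembly S₀).𝒯.Rel k i X → ∀ m : Fin ((assembly S₀).𝒯.len i + 1),
      (∀ o ∈ ball (⟨opOf S₀.F S₀.rawB g U k, hMB g U k⟩ : M) (R' k),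
        AEStronglyMeasurable (Function.uncurry ((factorCores (assembly S₀).𝒯 𝔠 i m).q (o : OpDatum E)))
          ((factorCores (assembly S₀).𝒯 𝔠 i m).lam.prod volume)) ∧
      (∀ p v, DifferentiableOn ℂ (fun o : M => (factorCores (assembly S₀).𝒯 𝔠 i m).q (o : OpDatum E) p v)
        (ball (⟨opOf S₀.F S₀.rawB g U k, hMB g U k⟩ : M) (R' k))) ∧
      (∀ o ∈ ball (⟨opOf S₀.F S₀.rawB g U k, hMB g U k⟩ : M) (R' k), ∀ p v,
        mf ((assembly S₀).𝒯.poly i m) ((assembly S₀).𝒯.lab i m) * ‖v‖ ^ 2 - bf ((assembly S₀).𝒯.poly i m) ((assembly S₀).𝒯.lab i m) ≤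
          ((factorCores (assembly S₀).𝒯 𝔠 i m).q (o : OpDatum E) p v).re))
    (hH : ∀ k, ∀ g ∈ W, ∀ U : R.carriers.BgB, ‖(assembly S₀).histRef g U k‖ + RHist k ≤ H k)
    (hκ : 0 ≤ κ) (hA0' : ∀ k Z ℓ, 0 ≤ A' k Z ℓ)
    (hdec : ∀ k Z ℓ, factorMass 𝔠 N₀f bf mstar (H k) Z ℓ ≤ A' k Z ℓ * Real.exp (-(κ * (R.carriers.d Z + 5))))
    (hΦ0 : 0 ≤ Φ') (hsmallΦ : 36 * Φ' < 1)
    (hΦ : ∀ (k : ℕ) (q : SCube R),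
      ∑ Z ∈ R.domAt k, ind (q ∈ footprint Z) * actSum (b13InnerData R) (A' k) k Z * Real.exp ((footprint Z).card) ≤ Φ')
    (hE₀ : 0 ≤ E₀) (hcA : 0 ≤ cA) (hcB : 0 ≤ cB) (hc₁ : 0 ≤ c₁) (hr₀ : 0 < r₀) (hδ' : 0 ≤ δ')
    (hθ0 : 0 < θ) (hθ1 : θ < 1) (hθθ' : θ ≤ θ') (hθ'1 : θ' ≤ 1) (hω : 0 < S₀.D.ω) (hω1 : S₀.D.ω < 1)
    (hh : cA * (EA₀ + E₀) < 1 - S₀.D.ω)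
    (hsmall : S₀.D.ω + Φ' / (1 - 36 * Φ') * cA * (1 - S₀.D.ω) / (1 - S₀.D.ω - cA * (EA₀ + E₀)) < θ') :
    ∃ C₅, NE5 (B13StepOfRecord.outA S₀ E₀ cB) (B13StepOfRecord.outB S₀ E₀ cB) W κ θ' C₅ := by
  have key := restrict_eq_onSub_comapCores S₀ M hMA hMB 𝔠 hact
  rw [← outA_restrict S₀ M hMA hMB E₀ cB, key] at hdA
  rw [← outB_restrict S₀ M hMA hMB E₀ cB, key] at hdB
  rw [← outA_restrict S₀ M hMA hMB E₀ cB, ← outB_restrict S₀ M hMA hMB E₀ cB, key]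
  exact exists_ne5_of_record_onSub_cores_actNorm S₀ M hMA hMB (comapCores 𝔠 ((↑) : M → OpDatum E)) E₀ cB hT hbB hbA hdA hdB hRA
    hRB hwer hfl hins hOp hroom hHist hm hmf hwB hN₀ hNf hqf hH hκ hA0' hdec hΦ0 hsmallΦ hΦ hE₀ hcA hcB hc₁ hr₀ hδ' hθ0 hθ1 hθθ' hθ'1
    hω hω1 hh hsmall

end Record

end Summit.QuantumFields.BalabanUV.T4Continuum.B13AssemblyCoresEndRestrict

end
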